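import Literature.MathematicalPhysics.QuantumFieldTheory.Balaban1983to89.B14RSplit

/-!
# `Balaban1983to89.B14RSplitCovariance` — CMP 119 §3 pp. 270–271: the COVARIANCE TRANSFER behind the split
# `𝐑_k = 𝐑′_k + 𝐑″_k` — *"Therefore the expression determined by the sum 𝐑′_k = Σ_{j=1}^{k₁} 𝐑^{(j)} is Euclidean
# covariant with respect to the Euclidean transformations leaving invariant the lattice T^{(k+1)}"* — PROVED as the
# lattice-geometric lemma it rests on: a Euclidean transformation of `ℤᵈ` that maps the partition into cubes of side
# `B` onto itself maps every nested partition into cubes of side `S ∣ B` onto itself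

statement-level skeleton of published theorems with citation tags; proofs where landed; nothing here is a claim
about the Yang–Mills mass gap.

CITATION HEADER (lean-in-tree rule).  Source: T. Bałaban, *Convergent renormalization expansions for lattice gauge
theories*, Commun. Math. Phys. **119**, 243–285 (1988), doi:10.1007/bf01217741 [Balaban1988Convergent] (cell paper
B14 = "[III]"; held `paper:balaban1988-cmp119-convergent-renormalization`, journal page = PDF page + 242; pp. 270–271
read on the x2 renders `…-p028-x2.png`/`…-p029-x2.png` and the text layer).  Mega-formalization `lit-balaban`, unit
`lit-balaban-r11` (CMP 119), SKELETON row `B14.Def§3.Rsplit` (the index `k₁`, `𝐑′_k`, `𝐑″_k` and the nesting of the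
`L`-adic partitions are r11 gen 1 `B14RSplit`, p240136).

THE PRINTED TEXT (pp. 270–271, verbatim): *"Let us recall that the Euclidean covariance property (2.32) holds for
Euclidean transformations leaving invariant the partition of the lattice T_η into L^{−(k−j)}MR_j-cubes. For k − j large
enough, more precisely for j ≤ k₁, where k₁ is the largest integer satisfying L^{−(k−k₁)}MR_j ≤ L, the cubes of the
partition are contained in L-cubes corresponding to the L-blocks. Therefore the expression determined by the sum
𝐑′_k = Σ_{j=1}^{k₁} 𝐑^{(j)} is Euclidean covariant with respect to the Euclidean transformations leaving invariant the
lattice T^{(k+1)}. It has the same covariance property as the expression determined by 𝐄_k, and we include it into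
𝐄_k."*  (2.32) p. 260: *"𝐑^{(j)}(rX, rU_j) = 𝐑^{(j)}(X, U_j) for the Euclidean transformations r which leave the partition
of the lattice T_ξ in MR_j-cubes invariant."*

WHAT IS PROVED (the step "Therefore").  All partitions in play are `L`-ADIC: cubes of side `S` (a power of `L` times
`MR_j`, itself a power of `L`: (2.5), `M = L^m`) anchored at multiples of `S`, i.e. the fibres of the label map
`x ↦ (⌊x_ν/S⌋)_ν` on `ℤᵈ` (`B14RSplit.ladic_nested_cube`: for `S ∣ B` every `S`-cube lies in a `B`-cube — print's
*"the cubes of the partition are contained in L-cubes"*).  A Euclidean transformation of the lattice is a map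
`x ↦ (ε_ν x_{σ(ν)} + a_ν)_ν` (a permutation `σ` of the axes, signs `ε_ν = ±1`, a translation `a ∈ ℤᵈ`).  THE LEMMA
(`preserves_cubes_of_dvd`): if such a map sends the partition into `B`-cubes to itself (print: *"leaving invariant the
lattice T^{(k+1)}"*, the `L`-block structure; `B` = the block side) then it sends the partition into `S`-cubes to itself
for EVERY `S ∣ B` (print: the `L^{−(k−j)}MR_j`-cubes, `j ≤ k₁`).  Mechanism, one axis at a time (§1): a translation
`t ↦ t + a` preserves the `B`-intervals iff `B ∣ a` (`dvd_of_translate_preserves`), a reflection `t ↦ −t + a` iff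
`B ∣ a + 1` (`dvd_of_reflect_preserves`), and both divisibilities descend from `B` to `S ∣ B`, where they give the
preservation back (`translate_preserves`, `reflect_preserves`).  THE TRANSFER (§3, `covariant_wrt_blocks`): (2.32) —
invariance of `𝐑^{(j)}` under every Euclidean map preserving the `S`-partition, an inductive HYPOTHESIS of [III] (row
B14.Eq2.32–2.33, `Step.LFCov`) — therefore yields invariance under every Euclidean map preserving the `B`-partition,
which is the printed sentence for each `𝐑^{(j)}`, `j ≤ k₁`, hence for their sum `𝐑′_k` (`B14RSplit.RPrime`,
`covariant_sum`).  Theorems only; no `sorry`; axioms standard.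
-/

namespace Literature.MathematicalPhysics.QuantumFieldTheory.Balaban1983to89.B14.RSplitCovariance

open Finset
open scoped BigOperators

/-! ## §1  One axis: which translations and reflections of `ℤ` preserve the partition into `n`-intervals -/

/-- Euclidean division with an explicit small remainder: `(n·q + r)/n = q` for `0 ≤ r < n`. [folklore] -/
private theorem ediv_eq_of_mul_add {n : ℤ} (hn : 0 < n) (q r : ℤ) (hr0 : 0 ≤ r) (hr : r < n) :
    (n * q + r) / n = q := by
  rw [Int.mul_add_ediv_left _ _ hn.ne', Int.ediv_eq_zero_of_lt hr0 hr, add_zero]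

/-- A reflection `t ↦ −t + a` with `n ∣ a + 1` acts on interval labels by `c ↦ (a+1)/n − 1 − c`.
[cite: Balaban1988Convergent, pp.270–271] -/
theorem neg_add_ediv_of_dvd {n : ℤ} (hn : 0 < n) {a : ℤ} (h : n ∣ a + 1) (t : ℤ) :
    (-t + a) / n = (a + 1) / n - 1 - t / n := by
  obtain ⟨m, hm⟩ := h
  have hq : (a + 1) / n = m := by rw [hm, Int.mul_ediv_cancel_left _ hn.ne']
  have h1 : -t + a = n * (m - 1 - t / n) + (n - 1 - t % n) := by
    have := Int.emod_def t n
    linear_combination hm + this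
  have hr0 : 0 ≤ n - 1 - t % n := by
    have := Int.emod_lt_of_pos t hn
    omega
  have hr : n - 1 - t % n < n := by
    have := Int.emod_nonneg t hn.ne'
    omega
  rw [h1, ediv_eq_of_mul_add hn _ _ hr0 hr, hq]

/-- A translation by a multiple of `n` maps `n`-intervals onto `n`-intervals. [cite: Balaban1988Convergent, pp.270–271] -/
theorem translate_preserves {n a : ℤ} (h : n ∣ a) {t t' : ℤ} (htt : t / n = t' / n) :
    (t + a) / n = (t' + a) / n := by
  rw [Int.add_ediv_of_dvd_right h, Int.add_ediv_of_dvd_right h, htt]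

/-- A reflection `t ↦ −t + a` with `n ∣ a + 1` maps `n`-intervals onto `n`-intervals. [cite: Balaban1988Convergent, pp.270–271] -/
theorem reflect_preserves {n : ℤ} (hn : 0 < n) {a : ℤ} (h : n ∣ a + 1) {t t' : ℤ} (htt : t / n = t' / n) :
    (-t + a) / n = (-t' + a) / n := by
  rw [neg_add_ediv_of_dvd hn h, neg_add_ediv_of_dvd hn h, htt]

/-- Conversely: a translation `t ↦ t + a` preserving the partition of `ℤ` into `B`-intervals has `B ∣ a` (test the
interval `[0, B)` at its two ends). [cite: Balaban1988Convergent, pp.270–271] -/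
theorem dvd_of_translate_preserves {B : ℤ} (hB : 0 < B) {a : ℤ}
    (h : ∀ t t' : ℤ, t / B = t' / B → (t + a) / B = (t' + a) / B) : B ∣ a := by
  have h0 : (0 : ℤ) / B = (B - 1) / B := by
    rw [Int.zero_ediv, Int.ediv_eq_zero_of_lt (by omega) (by omega)]
  have h1 := h 0 (B - 1) h0
  rw [zero_add] at h1
  by_contra hnd
  have hr : a % B ≠ 0 := fun h0' => hnd (Int.dvd_of_emod_eq_zero h0')
  have hr0 := Int.emod_nonneg a hB.ne'
  have hr1 := Int.emod_lt_of_pos a hB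
  have h2 : (B - 1 + a) / B = a / B + 1 := by
    have e : B - 1 + a = B * (a / B + 1) + (a % B - 1) := by
      have := Int.emod_def a B
      linear_combination -this
    rw [e]
    exact ediv_eq_of_mul_add hB _ _ (by omega) (by omega)
  omega

/-- Conversely: a reflection `t ↦ −t + a` preserving the partition of `ℤ` into `B`-intervals has `B ∣ a + 1`.
[cite: Balaban1988Convergent, pp.270–271] -/
theorem dvd_of_reflect_preserves {B : ℤ} (hB : 0 < B) {a : ℤ}
    (h : ∀ t t' : ℤ, t / B = t' / B → (-t + a) / B = (-t' + a) / B) : B ∣ a + 1 := by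
  have h0 : (0 : ℤ) / B = (B - 1) / B := by
    rw [Int.zero_ediv, Int.ediv_eq_zero_of_lt (by omega) (by omega)]
  have h1 := h 0 (B - 1) h0
  rw [neg_zero, zero_add] at h1
  by_contra hnd
  have hr : (a + 1) % B ≠ 0 := fun h0' => hnd (Int.dvd_of_emod_eq_zero h0')
  have hr0 := Int.emod_nonneg (a + 1) hB.ne'
  have hr1 := Int.emod_lt_of_pos (a + 1) hB
  have hd := Int.emod_def (a + 1) B
  have h2 : a / B = (a + 1) / B := by
    have e : a = B * ((a + 1) / B) + ((a + 1) % B - 1) := by linear_combination -hd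
    conv_lhs => rw [e]
    exact ediv_eq_of_mul_add hB _ _ (by omega) (by omega)
  have h3 : (-(B - 1) + a) / B = (a + 1) / B - 1 := by
    have e : -(B - 1) + a = B * ((a + 1) / B - 1) + (a + 1) % B := by linear_combination -hd
    rw [e]
    exact ediv_eq_of_mul_add hB _ _ hr0 hr1
  omega

/-! ## §2  `ℤᵈ`: Euclidean maps preserving the `B`-cubes preserve the `S`-cubes for every `S ∣ B` -/

section Lattice

variable {d : ℕ}

/-- **THE LEMMA behind p. 270's "Therefore".**  Let `r(x)_ν = ε_ν x_{σ(ν)} + a_ν` be a Euclidean transformation of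
`ℤᵈ` (`σ` a map of the axes, `ε_ν ∈ {1, −1}`, `a ∈ ℤᵈ`).  If `r` maps the partition into `B`-cubes (cube label
`x ↦ (⌊x_ν/B⌋)_ν`) to itself — sites in one `B`-cube go to one `B`-cube —, then for every `S ∣ B`, `S > 0`, it maps the
partition into `S`-cubes to itself.  (Print: the partition into `L^{−(k−j)}MR_j`-cubes, `j ≤ k₁`, is nested in the
`L`-block partition — `B14RSplit.ladic_nested_cube` —, and the transformations *"leaving invariant the lattice
T^{(k+1)}"* therefore leave it invariant.) [cite: Balaban1988Convergent, pp.270–271] -/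
theorem preserves_cubes_of_dvd {B S : ℤ} (hB : 0 < B) (hS : 0 < S) (hSB : S ∣ B) (σ : Fin d → Fin d)
    {ε : Fin d → ℤ} (hε : ∀ ν, ε ν = 1 ∨ ε ν = -1) (a : Fin d → ℤ)
    (h : ∀ x y : Fin d → ℤ, (∀ ν, x ν / B = y ν / B) → ∀ ν, (ε ν * x (σ ν) + a ν) / B = (ε ν * y (σ ν) + a ν) / B)
    (x y : Fin d → ℤ) (hxy : ∀ ν, x ν / S = y ν / S) (ν : Fin d) :
    (ε ν * x (σ ν) + a ν) / S = (ε ν * y (σ ν) + a ν) / S := by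
  -- the one-axis map `t ↦ ε_ν t + a_ν` preserves `B`-intervals: test on lines along the axis `σ ν`
  have h1 : ∀ t t' : ℤ, t / B = t' / B → (ε ν * t + a ν) / B = (ε ν * t' + a ν) / B := by
    intro t t' htt
    have := h (fun μ => if μ = σ ν then t else 0) (fun μ => if μ = σ ν then t' else 0) (by
      intro μ
      by_cases hμ : μ = σ ν
      · simp [hμ, htt]
      · simp [hμ]) ν
    simpa using this
  rcases hε ν with he | he
  · -- translation
    rw [he, one_mul, one_mul]
    have hdB : B ∣ a ν := dvd_of_translate_preserves hB (by simpa [he] using h1)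
    exact translate_preserves (dvd_trans hSB hdB) (hxy (σ ν))
  · -- reflection
    rw [he, neg_one_mul, neg_one_mul]
    have hdB : B ∣ a ν + 1 := dvd_of_reflect_preserves hB (by simpa [he] using h1)
    exact reflect_preserves hS (dvd_trans hSB hdB) (hxy (σ ν))

/-! ## §3  The transfer of (2.32): covariance for the finer partition gives covariance for `T^{(k+1)}` -/

/-- **p. 270, "Therefore … 𝐑′_k is Euclidean covariant with respect to the Euclidean transformations leaving invariant
the lattice T^{(k+1)}"** — the logic of the sentence, for ANY property `Φ` of Euclidean maps (read: `Φ r` = «𝐑^{(j)} is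
invariant under r», the (2.32) shape of `Step.LFCov`): if (2.32) gives `Φ r` for every Euclidean `r` preserving the
`S`-cube partition (`S` = the side `L^{−(k−j)}MR_j`, in lattice units), then `Φ r` holds for every Euclidean `r`
preserving the `B`-cube partition (`B` = the block side), as soon as `S ∣ B` — which is the condition `j ≤ k₁`
(`B14RSplit.covCond`, all sides powers of `L`). [cite: Balaban1988Convergent, pp.270–271, (2.32) p.260] -/
theorem covariant_wrt_blocks {B S : ℤ} (hB : 0 < B) (hS : 0 < S) (hSB : S ∣ B)
    (Φ : ((Fin d → ℤ) → (Fin d → ℤ)) → Prop)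
    (h232 : ∀ (σ : Fin d → Fin d) (ε a : Fin d → ℤ), (∀ ν, ε ν = 1 ∨ ε ν = -1) →
      (∀ x y : Fin d → ℤ, (∀ ν, x ν / S = y ν / S) → ∀ ν, (ε ν * x (σ ν) + a ν) / S = (ε ν * y (σ ν) + a ν) / S) →
      Φ (fun x ν => ε ν * x (σ ν) + a ν))
    (σ : Fin d → Fin d) (ε a : Fin d → ℤ) (hε : ∀ ν, ε ν = 1 ∨ ε ν = -1)
    (hBpres : ∀ x y : Fin d → ℤ, (∀ ν, x ν / B = y ν / B) →
      ∀ ν, (ε ν * x (σ ν) + a ν) / B = (ε ν * y (σ ν) + a ν) / B) :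
    Φ (fun x ν => ε ν * x (σ ν) + a ν) :=
  h232 σ ε a hε (fun x y hxy ν => preserves_cubes_of_dvd hB hS hSB σ hε a hBpres x y hxy ν)

/-- The same for a finite SUM of covariant terms — `𝐑′_k = Σ_{j=1}^{k₁} 𝐑^{(j)}` (`B14RSplit.RPrime`): if every
`𝐑^{(j)}`, `j ≤ k₁`, is invariant under a map `r` then so is `𝐑′_k` (values in any additive commutative monoid, the
terms as functions of the transformed argument). [cite: Balaban1988Convergent, p.271] -/
theorem covariant_sum {X α : Type*} [AddCommMonoid α] (Rj : ℕ → X → α) (r : X → X) (k₁ : ℕ)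
    (h : ∀ j ∈ Ico 1 (k₁ + 1), ∀ x, Rj j (r x) = Rj j x) (x : X) :
    B14.RSplit.RPrime (fun j => Rj j (r x)) k₁ = B14.RSplit.RPrime (fun j => Rj j x) k₁ := by
  unfold B14.RSplit.RPrime
  exact Finset.sum_congr rfl fun j hj => h j hj x

end Lattice

end Literature.MathematicalPhysics.QuantumFieldTheory.Balaban1983to89.B14.RSplitCovariance
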